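import Literature.AlgebraicGeometry.Resolution.AlterationsGraphClosure
import Literature.AlgebraicGeometry.Resolution.SemiStableCurvesDimension
import Literature.AlgebraicGeometry.Resolution.SemiStableFibreBranches
import Literature.AlgebraicGeometry.Resolution.FibresOfBaseChange
import Literature.AlgebraicGeometry.Motives.CyclesEquivalencesProofs
import Literature.AlgebraicGeometry.Dimension.FibreLocalRingDimension
import Mathlib.AlgebraicGeometry.Geometrically.Connected
import HarnessLib

/-!
# De Jong 1996, 4.19: "`T_s` has pure dimension 1 as `T → S` is flat" — the fibres of the
# closure `T` of the graph of `β` have dimension at most one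

Topic: `Literature/AlgebraicGeometry/Resolution`. In Situation 4.18 of de Jong 1996
(`DeJong1996.ThreePointSituation`), with the closure `T ⊆ 𝒞 ×_S X` of the graph of `β`
(`DeJong1996.graphClosure`) flat over the Noetherian base `S` (hypothesis h) of 4.18), the text
opens the proof of Lemma 4.20 with "Note that `T_s` has pure dimension 1 as `T → S` is flat"
(4.19, p. 73). This file proves the part of it used in 4.20–4.21: for every `t ∈ T` over `s`,

`dim 𝒪_{S,s} ≤ dim 𝒪_{T,t} ≤ dim 𝒪_{S,s} + 1`

(`DeJong1996.ThreePointSituation.coheight_le_coheight_graphClosure`,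
`DeJong1996.ThreePointSituation.coheight_graphClosure_le`), i.e. the local rings of the fibre
`T_s` have dimension `≤ 1`; consequently a fibre of `T → S` contains no chain of three distinct
points under specialization (`not_three_specializes_fiber_graphClosure`).

Proof. The lower bound is the dimension formula for the flat `T → S` (EGA IV 6.1.2,
`Literature.AlgebraicGeometry.Motives.coheight_eq_coheight_add_ringKrullDim_stalk_fiber`). For
the upper bound at a point `t` closed in its fibre, write `θ = (c, x) ∈ P = 𝒞 ×_S X` for the
image of `t`: the projection `P → X` is flat (base change of the semi-stable `𝒞 → S`) with fibre
`𝒞_s ⊗_{κ(s)} κ(x)` at `x`, of dimension `1` (`x` is closed in `X_s`, so `κ(x)/κ(s)` is finite),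
and `X → S` is flat with fibres of dimension `1`, so `dim 𝒪_{P,θ} ≤ dim 𝒪_{S,s} + 2`; and
`dim 𝒪_{T,t} + 1 ≤ dim 𝒪_{P,θ}` because `T` is not an irreducible component of `P`
(`exists_specializes_graphClosureι_genericPoint`): otherwise the point defined by the generic
point of `T` in the fibre of `P → 𝒞` over the generic point `η_𝒞` — which is the base change
of the geometrically connected generic fibre `X_η` to `K(𝒞)`, hence connected — would be both
closed (it is the only point of `T` over `η_𝒞`, `pr₁ : T → 𝒞` being an isomorphism over `𝒞_U`)
and maximal, hence the whole fibre, forcing `X_η` to be a point, whereas it is a curve.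

## References

* A. J. de Jong, *Smoothness, semi-stability and alterations*, Publ. Math. IHÉS 83 (1996),
  4.18–4.19, pp. 72–73.
* A. Grothendieck, J. Dieudonné, EGA IV₂, Cor. 6.1.2.
-/

noncomputable section

open CategoryTheory CategoryTheory.Limits AlgebraicGeometry TopologicalSpace Topology Order

namespace Literature.AlgebraicGeometry.Resolution

universe u

/-! ## Order theory: an embedded chain can be extended past the top -/

/-- If `f : α → β` is strictly monotone and `z` lies strictly above the image of `f`, then every
chain above `x` in `α` gives a chain above `f x` in `β` which can be prolonged by `z`:
`coheight x + 1 ≤ coheight (f x)`. [folklore] -/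
theorem coheight_add_one_le_coheight_apply {α β : Type*} [Preorder α] [Preorder β] (f : α → β)
    (hf : StrictMono f) {z : β} (hz : ∀ a, f a < z) (x : α) :
    coheight x + 1 ≤ coheight (f x) := by
  -- chains above `x` of every finite length `≤ coheight x` extend
  have key : ∀ n : ℕ, (n : ℕ∞) ≤ coheight x → (n : ℕ∞) + 1 ≤ coheight (f x) := by
    intro n hn
    obtain ⟨q, hqx, hqn⟩ := Order.exists_series_of_le_coheight x hn
    have hlast : (q.map f hf).last < z := by
      rw [LTSeries.last_map]
      exact hz _
    let q' : LTSeries β := (q.map f hf).snoc z hlast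
    have hq'head : q'.head = f x := by
      simp only [q', RelSeries.head_snoc, LTSeries.head_map, hqx]
    have hq'len : q'.length = n + 1 := by
      simp only [q', RelSeries.snoc_length, LTSeries.map_length, hqn]
    have := Order.length_le_coheight (le_of_eq hq'head.symm)
    rw [hq'len] at this
    exact_mod_cast this
  rcases (le_top : coheight x ≤ ⊤).eq_or_lt with htop | hlt
  · -- infinite coheight: all finite lengths occur
    rw [htop]
    have : coheight (f x) = ⊤ := by
      rw [ENat.eq_top_iff_forall_ge]
      intro n
      have := key n (by rw [htop]; exact le_top)
      exact le_trans (by exact_mod_cast Nat.le_succ n) this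
    rw [this]
    exact le_top
  · obtain ⟨n, hn⟩ := ENat.ne_top_iff_exists.mp hlt.ne
    rw [← hn]
    exact key n (le_of_eq hn)

/-! ## Topology: a closed maximal point of a Noetherian space is open -/

/-- In a Noetherian space, a point which is closed and is the generic point of an irreducible
component is open: its complement is the union of the other (finitely many, closed) irreducible
components. [folklore] -/
theorem isOpen_singleton_of_isClosed_of_mem_genericPoints {X : Type*} [TopologicalSpace X]
    [NoetherianSpace X] {x : X} (hcl : IsClosed ({x} : Set X)) (hgen : x ∈ genericPoints X) :
    IsOpen ({x} : Set X) := by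
  have hcomp : ({x} : Set X) ∈ irreducibleComponents X := by
    have : closure ({x} : Set X) ∈ irreducibleComponents X := hgen
    rwa [hcl.closure_eq] at this
  -- the union of the other components is closed
  let R : Set (Set X) := irreducibleComponents X \ {{x}}
  have hRfin : R.Finite := NoetherianSpace.finite_irreducibleComponents.subset Set.sdiff_subset
  have hRcl : IsClosed (⋃₀ R) := by
    rw [Set.sUnion_eq_biUnion]
    exact hRfin.isClosed_biUnion fun C hC => isClosed_of_mem_irreducibleComponents C hC.1
  -- and its complement is `{x}`
  have key : (⋃₀ R)ᶜ = {x} := by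
    ext y
    simp only [Set.mem_compl_iff, Set.mem_sUnion, not_exists, not_and, Set.mem_singleton_iff]
    constructor
    · intro hy
      -- `y` lies in some component, which must be `{x}`
      have hyC := irreducibleComponent_mem_irreducibleComponents y
      by_contra hne
      have hCne : irreducibleComponent y ≠ {x} := by
        intro hC
        have : y ∈ ({x} : Set X) := hC ▸ mem_irreducibleComponent
        exact hne this
      exact hy _ ⟨hyC, hCne⟩ mem_irreducibleComponent
    · intro hyx C hC hxC
      -- `{x} ⊆ C`, both components, hence equal
      rw [hyx] at hxC
      apply hC.2
      have hsub : ({x} : Set X) ⊆ C := Set.singleton_subset_iff.mpr hxC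
      exact Set.Subset.antisymm (hcomp.2 hC.1.1 hsub) hsub
  rw [← key]
  exact hRcl.isOpen_compl

/-! ## `T` is not an irreducible component of `𝒞 ×_S X` -/

namespace DeJong1996.ThreePointSituation

variable {X S C : Scheme.{u}} [IsIntegral S] {f : X ⟶ S} [LocallyOfFinitePresentation f] {n : ℕ}
  {σ : Fin n → (S ⟶ X)} {p : C ⟶ S} {τ : Fin n → (S ⟶ C)} {U : S.Opens}
  {β : ((p ⁻¹ᵁ U : C.Opens) : Scheme.{u}) ⟶ (f ⁻¹ᵁ U : X.Opens)}

/-- **`pr₁ : T → 𝒞` is injective over `𝒞_U`** (it is an isomorphism there,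
`isIso_graphClosureFst_morphismRestrict`). [cite: DeJong1996, 4.19, p. 73] -/
theorem eq_of_graphClosureFst_eq [IsNoetherian S] (h : ThreePointSituation f σ p τ U β)
    {t₁ t₂ : ↥(graphClosure f p U β h.comm)}
    (he : graphClosureFst f p U β h.comm t₁ = graphClosureFst f p U β h.comm t₂)
    (hU : graphClosureFst f p U β h.comm t₁ ∈ p ⁻¹ᵁ U) : t₁ = t₂ := by
  haveI := h.isSeparated
  haveI := h.quasiCompact_graphMorphism
  haveI := h.isIntegral_preimage
  obtain ⟨hiso, -⟩ := isIso_graphClosureFst_morphismRestrict f p U β h.comm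
  haveI := hiso
  have hinj : Function.Injective (graphClosureFst f p U β h.comm ∣_ (p ⁻¹ᵁ U)) :=
    (graphClosureFst f p U β h.comm ∣_ (p ⁻¹ᵁ U)).homeomorph.injective
  have h1 : t₁ ∈ graphClosureFst f p U β h.comm ⁻¹ᵁ (p ⁻¹ᵁ U) := hU
  have h2 : t₂ ∈ graphClosureFst f p U β h.comm ⁻¹ᵁ (p ⁻¹ᵁ U) := by
    show graphClosureFst f p U β h.comm t₂ ∈ p ⁻¹ᵁ U
    rw [← he]
    exact hU
  have key : (graphClosureFst f p U β h.comm ∣_ (p ⁻¹ᵁ U)) ⟨t₁, h1⟩ =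
      (graphClosureFst f p U β h.comm ∣_ (p ⁻¹ᵁ U)) ⟨t₂, h2⟩ := by
    apply Subtype.ext
    rw [morphismRestrict_base_coe, morphismRestrict_base_coe]
    exact he
  exact congrArg Subtype.val (hinj key)

/-- The generic point of `T` maps to the generic point of `𝒞` (`pr₁` is birational, in
particular dominant). [cite: DeJong1996, 4.19, p. 73] -/
theorem graphClosureFst_genericPoint [IsNoetherian S] (h : ThreePointSituation f σ p τ U β) :
    haveI := h.isIntegral_graphClosure
    haveI := h.isIntegral_model
    graphClosureFst f p U β h.comm (genericPoint ↥(graphClosure f p U β h.comm)) =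
      genericPoint C := by
  haveI := h.isIntegral_graphClosure
  haveI := h.isIntegral_model
  haveI := h.isBirational_graphClosureFst.isDominant
  exact genericPoint_eq_of_isDominant _

/-- The generic point of `𝒞` lies in `𝒞_U`. [folklore] -/
theorem genericPoint_mem_preimage (h : ThreePointSituation f σ p τ U β) :
    haveI := h.isIntegral_model
    genericPoint C ∈ p ⁻¹ᵁ U := by
  haveI := h.isIntegral_model
  obtain ⟨c, hc⟩ := h.nonempty_preimage
  exact ((genericPoint_spec C).mem_open_set_iff (p ⁻¹ᵁ U).isOpen).mpr ⟨c, Set.mem_univ _, hc⟩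

/-- `p` maps the generic point of `𝒞` to the generic point of `S`. [folklore] -/
theorem apply_genericPoint_model (h : ThreePointSituation f σ p τ U β) :
    haveI := h.isIntegral_model
    p (genericPoint C) = genericPoint S := by
  haveI := h.isIntegral_model
  haveI := h.isPointedSemiStableCurve.isSemiStableCurve.isDominant
  exact genericPoint_eq_of_isDominant p

/-- **`T` is not an irreducible component of `P = 𝒞 ×_S X`: its generic point has a proper
generization in `P`.** Otherwise, in the fibre of `pr₁ : P → 𝒞` over the generic point `η_𝒞` —
the base change of the generic fibre `X_η` to `K(𝒞)`, connected as `X_η` is geometrically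
connected (4.18 a)) — the point defined by the generic point of `T` would be maximal and closed
(`T` has only this point over `η_𝒞`, as `pr₁ : T → 𝒞` is injective over `𝒞_U`), hence open
(Noetherian), hence everything; then all points of `X` over `η_S` would coincide and the
generic fibre `X_η` would be a point, contradicting 4.18 a) (its components are curves).
[cite: DeJong1996, 4.18–4.19, pp. 72–73] -/
theorem exists_specializes_graphClosureι_genericPoint [IsNoetherian S]
    (h : ThreePointSituation f σ p τ U β) :
    haveI := h.isIntegral_graphClosure
    ∃ θ' : ↥(pullback p f), θ' ⤳ graphClosureι f p U β h.comm
      (genericPoint ↥(graphClosure f p U β h.comm)) ∧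
      θ' ≠ graphClosureι f p U β h.comm (genericPoint ↥(graphClosure f p U β h.comm)) := by
  haveI := h.isIntegral_graphClosure
  haveI := h.isIntegral_model
  haveI := h.isProper
  haveI := h.isCurveFibration.geometricallyConnected
  haveI := h.isCurveFibration.surjective
  by_contra hcon
  push Not at hcon
  have hθc : pullback.fst p f (graphClosureι f p U β h.comm
      (genericPoint ↥(graphClosure f p U β h.comm))) = genericPoint C :=
    graphClosureFst_genericPoint h
  -- the fibre of `pr₁ : P → 𝒞` over `η_𝒞` and its point defined by the generic point of `T`
  have hmax : (((pullback.fst p f).fiberHomeo (genericPoint C)).symm ⟨_, hθc⟩) ∈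
      genericPoints ↥((pullback.fst p f).fiber (genericPoint C)) :=
    fiberHomeo_symm_mem_genericPoints (pullback.fst p f) hθc (fun e _ he => hcon e he)
  have hcl : IsClosed ({((pullback.fst p f).fiberHomeo (genericPoint C)).symm ⟨_, hθc⟩} :
      Set ↥((pullback.fst p f).fiber (genericPoint C))) := by
    refine isClosed_singleton_fiberHomeo_symm (pullback.fst p f) hθc (fun e hec hθe => ?_)
    have hrange : e ∈ Set.range (graphClosureι f p U β h.comm) := by
      have hclosed : IsClosed (Set.range (graphClosureι f p U β h.comm)) :=
        (graphClosureι f p U β h.comm).isClosedEmbedding.isClosed_range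
      exact hclosed.closure_subset_iff.mpr (Set.singleton_subset_iff.mpr ⟨_, rfl⟩)
        (specializes_iff_mem_closure.mp hθe)
    obtain ⟨t', rfl⟩ := hrange
    have heq : graphClosureFst f p U β h.comm t' =
        graphClosureFst f p U β h.comm (genericPoint ↥(graphClosure f p U β h.comm)) := by
      show pullback.fst p f (graphClosureι f p U β h.comm t') = _
      rw [hec, graphClosureFst_genericPoint h]
    have hU : graphClosureFst f p U β h.comm t' ∈ p ⁻¹ᵁ U := by
      rw [heq, graphClosureFst_genericPoint h]; exact genericPoint_mem_preimage h
    rw [eq_of_graphClosureFst_eq h heq hU]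
  -- the fibre is Noetherian and connected, so it is this single point
  haveI : LocallyOfFiniteType ((pullback.fst p f).fiberToSpecResidueField (genericPoint C)) :=
    MorphismProperty.pullback_snd (P := @LocallyOfFiniteType) _ _ inferInstance
  haveI : IsLocallyNoetherian ((pullback.fst p f).fiber (genericPoint C)) :=
    LocallyOfFiniteType.isLocallyNoetherian
      (f := (pullback.fst p f).fiberToSpecResidueField (genericPoint C))
  haveI : IsNoetherian ((pullback.fst p f).fiber (genericPoint C)) := {}
  have hopen := isOpen_singleton_of_isClosed_of_mem_genericPoints hcl hmax
  have huniv := IsClopen.eq_univ ⟨hcl, hopen⟩ (Set.singleton_nonempty _)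
  -- hence every point of `X` over `η_S` is `pr₂` of the generic point of `T`
  have hpη := apply_genericPoint_model h
  have hsub : ∀ x : X, f x = genericPoint S → x = pullback.snd p f
      (graphClosureι f p U β h.comm (genericPoint ↥(graphClosure f p U β h.comm))) := by
    intro x hx
    obtain ⟨z, hz1, hz2⟩ := Scheme.Pullback.exists_preimage_pullback (f := p) (g := f)
      (genericPoint C) x (hpη.trans hx.symm)
    have hmem : ((pullback.fst p f).fiberHomeo (genericPoint C)).symm ⟨z, hz1⟩ ∈
        ({((pullback.fst p f).fiberHomeo (genericPoint C)).symm ⟨_, hθc⟩} :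
          Set ↥((pullback.fst p f).fiber (genericPoint C))) := by
      rw [huniv]; exact Set.mem_univ _
    have hzθ := congrArg (fun w => ((pullback.fst p f).fiberι (genericPoint C) w : ↥(pullback p f)))
      (Set.mem_singleton_iff.mp hmem)
    simp only [Scheme.Hom.fiberι_fiberHomeo_symm] at hzθ
    rw [← hz2, hzθ]
  -- so the generic fibre of `f` is a single point; but its components are curves
  haveI : Subsingleton ↥(f.fiber (genericPoint S)) := ⟨fun a b => by
    apply (f.fiberι (genericPoint S)).isEmbedding.injective
    rw [hsub _ (Literature.AlgebraicGeometry.Motives.apply_fiberι f _ a),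
      hsub _ (Literature.AlgebraicGeometry.Motives.apply_fiberι f _ b)]⟩
  obtain ⟨x₀, hx₀⟩ := f.surjective (genericPoint S)
  let xb : ↥(f.fiber (genericPoint S)) := (f.fiberHomeo (genericPoint S)).symm ⟨x₀, hx₀⟩
  have h1 := h.isCurveFibration.topologicalKrullDim_eq_one (genericPoint S) _
    (irreducibleComponent_mem_irreducibleComponents xb)
  have h0 : topologicalKrullDim ↥(irreducibleComponent xb) ≤ 0 :=
    (topologicalKrullDim_subspace_le _ _).trans (topologicalKrullDim_zero_of_discreteTopology _)
  rw [h1] at h0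
  exact absurd h0 (by decide)

end DeJong1996.ThreePointSituation

/-! ## Points closed in their fibre: residue fields and fibre dimension -/

/-- **A point closed in its fibre has residue field algebraic over that of the base**: for
`g : Y → Z` locally of finite type and `y ∈ Y` closed in the fibre `Y_{g y}`, the morphism
`Spec κ(y) → Spec κ(g y)` is finite (it is `Spec κ(y) → Y_{g y} → Spec κ(g y)`, a closed point
of a scheme locally of finite type over a field — Mathlib's form of Zariski's lemma), in
particular integral. [folklore] -/
theorem isIntegralHom_SpecMap_residueFieldMap_of_isClosed {Y Z : Scheme.{u}} (g : Y ⟶ Z)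
    [LocallyOfFiniteType g] (y : Y) (hy : IsClosed ({g.asFiber y} : Set ↥(g.fiber (g y)))) :
    IsIntegralHom (Spec.map (g.residueFieldMap y)) := by
  haveI : IsClosedImmersion (g.asFiberHom y) :=
    .of_isPreimmersion _ (by rw [Scheme.Hom.range_asFiberHom]; exact hy)
  haveI : LocallyOfFiniteType (g.fiberToSpecResidueField (g y)) :=
    MorphismProperty.pullback_snd (P := @LocallyOfFiniteType) _ _ inferInstance
  have h1 : LocallyOfFiniteType (Spec.map (g.residueFieldMap y)) := by
    rw [← Scheme.Hom.asFiberHom_fiberToSpecResidueField]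
    infer_instance
  haveI : IsFinite (Spec.map (g.residueFieldMap y)) :=
    isFinite_iff_locallyOfFiniteType_of_jacobsonSpace.mpr h1
  infer_instance

/-- A point of `𝒞` is closed in its fibre (no other point of the fibre is a specialization of
it) iff the corresponding point of the fibre scheme is closed; the direction used here.
[folklore] -/
theorem isClosed_singleton_asFiber {Y Z : Scheme.{u}} (g : Y ⟶ Z) {y : Y}
    (H : ∀ e : Y, g e = g y → y ⤳ e → e = y) : IsClosed ({g.asFiber y} : Set ↥(g.fiber (g y))) :=
  isClosed_singleton_fiberHomeo_symm g rfl H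

/-- **Base change of a one-dimensional fibre along an algebraic residue field extension.** Let
`p : 𝒞 → S` have fibres of dimension `≤ 1`, `f : X → S` locally of finite type, and `x ∈ X`
closed in its fibre. Then the fibre of `pr_X : 𝒞 ×_S X → X` at `x` — the base change of
`𝒞_{f x}` along the algebraic extension `κ(x)/κ(f x)` (Stacks 01JT), which is integral and
surjective over `𝒞_{f x}` — has dimension `≤ 1` (Stacks 0ECG). [cite: StacksProject, Tag 0ECG] -/
theorem topologicalKrullDim_fiber_pullback_snd_le {X S C : Scheme.{u}} (p : C ⟶ S) (f : X ⟶ S)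
    [LocallyOfFiniteType f] (hp : ∀ s : S, topologicalKrullDim ↥(p.fiber s) ≤ 1) (x : X)
    (hx : IsClosed ({f.asFiber x} : Set ↥(f.fiber (f x)))) :
    topologicalKrullDim ↥((pullback.snd p f).fiber x) ≤ 1 := by
  obtain ⟨π, hπ, -⟩ := exists_isPullback_fiber_snd p f x
  haveI := isIntegralHom_SpecMap_residueFieldMap_of_isClosed f x hx
  haveI : IsIntegralHom π := MorphismProperty.of_isPullback hπ.flip inferInstance
  haveI : Surjective π := MorphismProperty.of_isPullback hπ.flip (surjective_SpecMap_of_field _)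
  rw [topologicalKrullDim_eq_of_isIntegralHom_of_surjective π]
  exact hp (f x)

/-- The local rings of a scheme of dimension `≤ 1` have dimension `≤ 1`
(`dim 𝒪_{F,z} = coheight z ≤ dim F`). [folklore] -/
theorem ringKrullDim_stalk_le_one_of_topologicalKrullDim_le {F : Scheme.{u}}
    (hF : topologicalKrullDim F ≤ 1) (z : F) : ringKrullDim (F.presheaf.stalk z) ≤ 1 := by
  rw [ringKrullDim_stalk_eq_coheight]
  calc ((coheight z : ℕ∞) : WithBot ℕ∞) ≤ krullDim F := Order.coheight_le_krullDim z
    _ = topologicalKrullDim F := (topologicalKrullDim_eq_krullDim_carrier F).symm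
    _ ≤ 1 := hF

/-- The inequality `coheight a ≤ coheight b + 1` from the dimension formula
`coheight a = coheight b + dim` with `dim ≤ 1`. [folklore] -/
theorem ENat.coheight_le_add_one_of_eq {a b : ℕ∞} {d : WithBot ℕ∞}
    (h : (a : WithBot ℕ∞) = b + d) (hd : d ≤ 1) : a ≤ b + 1 := by
  have : (a : WithBot ℕ∞) ≤ (b : WithBot ℕ∞) + 1 := by
    rw [h]
    exact add_le_add le_rfl hd
  exact_mod_cast this

/-! ## The dimension of the fibres of `T → S` -/

namespace DeJong1996.ThreePointSituation

variable {X S C : Scheme.{u}} [IsIntegral S] {f : X ⟶ S} [LocallyOfFinitePresentation f] {n : ℕ}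
  {σ : Fin n → (S ⟶ X)} {p : C ⟶ S} {τ : Fin n → (S ⟶ C)} {U : S.Opens}
  {β : ((p ⁻¹ᵁ U : C.Opens) : Scheme.{u}) ⟶ (f ⁻¹ᵁ U : X.Opens)}

/-- `T → S` is locally of finite type. [folklore] -/
theorem locallyOfFiniteType_graphClosureMap (h : ThreePointSituation f σ p τ U β) :
    LocallyOfFiniteType (graphClosureMap f p U β h.comm) := by
  haveI := h.isPointedSemiStableCurve.isSemiStableCurve.locallyOfFinitePresentation
  delta graphClosureMap graphClosureFst
  infer_instance

/-- `T` is locally Noetherian (of finite type over the Noetherian `S`). [folklore] -/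
theorem isLocallyNoetherian_graphClosure [IsNoetherian S] (h : ThreePointSituation f σ p τ U β) :
    IsLocallyNoetherian (graphClosure f p U β h.comm) :=
  haveI := h.locallyOfFiniteType_graphClosureMap
  LocallyOfFiniteType.isLocallyNoetherian (f := graphClosureMap f p U β h.comm)

/-- `𝒞 ×_S X` is locally Noetherian. [folklore] -/
theorem isLocallyNoetherian_pullback [IsNoetherian S] (h : ThreePointSituation f σ p τ U β) :
    IsLocallyNoetherian (pullback p f) := by
  haveI := h.isPointedSemiStableCurve.isSemiStableCurve.locallyOfFinitePresentation
  haveI : IsLocallyNoetherian C := LocallyOfFiniteType.isLocallyNoetherian (f := p)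
  exact LocallyOfFiniteType.isLocallyNoetherian (f := pullback.fst p f)

/-- **`dim 𝒪_{T,t} + 1 ≤ dim 𝒪_{P,t}` for `P = 𝒞 ×_S X`**: a chain of specializations above `t`
in `T` ends at the generic point of `T`, which has a proper generization in `P`
(`exists_specializes_graphClosureι_genericPoint`). [cite: DeJong1996, 4.19, p. 73] -/
theorem coheight_add_one_le_coheight_graphClosureι [IsNoetherian S]
    (h : ThreePointSituation f σ p τ U β) (t : ↥(graphClosure f p U β h.comm)) :
    coheight t + 1 ≤ coheight (graphClosureι f p U β h.comm t) := by
  haveI := h.isIntegral_graphClosure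
  obtain ⟨θ', hθ', hne⟩ := h.exists_specializes_graphClosureι_genericPoint
  have hemb := (graphClosureι f p U β h.comm).isEmbedding
  refine coheight_add_one_le_coheight_apply (graphClosureι f p U β h.comm) ?_ (z := θ') ?_ t
  · -- `ι` is strictly monotone for the specialization orders
    intro a b hab
    rw [lt_iff_le_not_ge, Scheme.le_iff_specializes, Scheme.le_iff_specializes] at hab ⊢
    exact ⟨hab.1.map (graphClosureι f p U β h.comm).continuous,
      fun hba => hab.2 (hemb.specializes_iff.mp hba)⟩
  · intro a
    rw [lt_iff_le_not_ge, Scheme.le_iff_specializes, Scheme.le_iff_specializes]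
    refine ⟨hθ'.trans ((genericPoint_specializes a).map (graphClosureι f p U β h.comm).continuous),
      fun haθ => hne ?_⟩
    -- `θ' ∈ closure {ι a} ⊆ T`, so `θ'` is a point of `T` generizing its generic point
    have hrange : θ' ∈ Set.range (graphClosureι f p U β h.comm) :=
      (graphClosureι f p U β h.comm).isClosedEmbedding.isClosed_range.closure_subset_iff.mpr
        (Set.singleton_subset_iff.mpr ⟨a, rfl⟩) (specializes_iff_mem_closure.mp haθ)
    obtain ⟨t', rfl⟩ := hrange
    have h1 : genericPoint ↥(graphClosure f p U β h.comm) ⤳ t' := genericPoint_specializes t'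
    have h2 : t' ⤳ genericPoint ↥(graphClosure f p U β h.comm) := hemb.specializes_iff.mp hθ'
    rw [(h2.antisymm h1).eq]

/-- **`dim 𝒪_{S,s} ≤ dim 𝒪_{T,t}`** for `t ∈ T` over `s` (the dimension formula for the flat
`T → S`, EGA IV 6.1.2). [cite: DeJong1996, 4.19, p. 73] -/
theorem coheight_le_coheight_graphClosure [IsNoetherian S] (h : ThreePointSituation f σ p τ U β)
    (hT : Flat (graphClosureMap f p U β h.comm)) (t : ↥(graphClosure f p U β h.comm)) :
    coheight (graphClosureMap f p U β h.comm t) ≤ coheight t := by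
  haveI := hT
  haveI := h.isLocallyNoetherian_graphClosure
  have e := Literature.AlgebraicGeometry.Motives.coheight_eq_coheight_add_ringKrullDim_stalk_fiber
    (graphClosureMap f p U β h.comm) t
  have h0 : (0 : WithBot ℕ∞) ≤ ringKrullDim (((graphClosureMap f p U β h.comm).fiber
      (graphClosureMap f p U β h.comm t)).presheaf.stalk ((graphClosureMap f p U β h.comm).asFiber t)) :=
    ringKrullDim_nonneg_of_nontrivial
  have : ((coheight (graphClosureMap f p U β h.comm t) : ℕ∞) : WithBot ℕ∞) ≤ coheight t := by
    rw [e]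
    exact le_add_of_nonneg_right h0
  exact_mod_cast this

/-- The upper bound at a point `t` whose image `x = pr₂ t` is closed in the fibre `X_{f x}`:
`dim 𝒪_{T,t} ≤ dim 𝒪_{S,s} + 1` — from `dim 𝒪_{T,t} + 1 ≤ dim 𝒪_{P,t}`,
`dim 𝒪_{P,t} = dim 𝒪_{X,x} + dim 𝒪_{P_x}` (`P → X` flat, base change of `𝒞 → S`) with
`dim P_x ≤ 1`, and `dim 𝒪_{X,x} = dim 𝒪_{S,s} + dim 𝒪_{X_s,x}` (`X → S` flat) with `dim X_s ≤ 1`.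
[cite: DeJong1996, 4.19, p. 73] -/
theorem coheight_graphClosure_le_of_isClosed [IsNoetherian S] (h : ThreePointSituation f σ p τ U β)
    (hX : Flat f) (t : ↥(graphClosure f p U β h.comm))
    (hx : IsClosed ({f.asFiber (graphClosureSnd f p U β h.comm t)} :
      Set ↥(f.fiber (f (graphClosureSnd f p U β h.comm t))))) :
    coheight t ≤ coheight (graphClosureMap f p U β h.comm t) + 1 := by
  haveI := hX
  haveI := h.isProper
  haveI := h.flat_model
  haveI := h.isLocallyNoetherian_pullback
  haveI : IsLocallyNoetherian X := LocallyOfFiniteType.isLocallyNoetherian (f := f)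
  have hsst := h.isPointedSemiStableCurve.isSemiStableCurve
  -- `dim 𝒪_{P,ι t} ≤ dim 𝒪_{X,x} + 1`
  have e1 := Literature.AlgebraicGeometry.Motives.coheight_eq_coheight_add_ringKrullDim_stalk_fiber
    (pullback.snd p f) (graphClosureι f p U β h.comm t)
  have d1 : ringKrullDim (((pullback.snd p f).fiber (pullback.snd p f (graphClosureι f p U β h.comm
      t))).presheaf.stalk ((pullback.snd p f).asFiber (graphClosureι f p U β h.comm t))) ≤ 1 :=
    ringKrullDim_stalk_le_one_of_topologicalKrullDim_le
      (topologicalKrullDim_fiber_pullback_snd_le p f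
        (fun s => le_of_eq (hsst.topologicalKrullDim_fiber_eq_one s)) _ hx) _
  have i1 := ENat.coheight_le_add_one_of_eq e1 d1
  -- `dim 𝒪_{X,x} ≤ dim 𝒪_{S,s} + 1`
  have e2 := Literature.AlgebraicGeometry.Motives.coheight_eq_coheight_add_ringKrullDim_stalk_fiber
    f (graphClosureSnd f p U β h.comm t)
  have d2 : ringKrullDim ((f.fiber (f (graphClosureSnd f p U β h.comm t))).presheaf.stalk
      (f.asFiber (graphClosureSnd f p U β h.comm t))) ≤ 1 :=
    ringKrullDim_stalk_le_one_of_topologicalKrullDim_le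
      (Literature.AlgebraicGeometry.Dimension.topologicalKrullDim_le_of_forall_mem_irreducibleComponents
        _ 1 (fun C hC => le_of_eq (h.isCurveFibration.topologicalKrullDim_eq_one _ C hC))) _
  have i2 := ENat.coheight_le_add_one_of_eq e2 d2
  -- `dim 𝒪_{T,t} + 1 ≤ dim 𝒪_{P, ι t}`
  have i3 := h.coheight_add_one_le_coheight_graphClosureι t
  -- combine
  have hs : f (graphClosureSnd f p U β h.comm t) = graphClosureMap f p U β h.comm t := by
    rw [graphClosureMap_eq]; rfl
  rw [← hs]
  have key : coheight t + 1 ≤ coheight (f (graphClosureSnd f p U β h.comm t)) + 1 + 1 :=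
    i3.trans (i1.trans (add_le_add i2 le_rfl))
  exact (ENat.add_le_add_iff_right ENat.one_ne_top).mp key

/-- **de Jong 1996, 4.19 ("`T_s` has pure dimension 1 as `T → S` is flat"), upper bound:
`dim 𝒪_{T,t} ≤ dim 𝒪_{S,s} + 1` for every `t ∈ T` over `s`**, i.e. the local rings of the
fibres `T_s` have dimension `≤ 1` (given the lower bound). Reduce to a specialization `t₀` of `t`
closed in the fibre (closed points exist in the quasi-compact fibre), whose image in `X` is then
closed in `X_s` (`pr₂` is closed), and apply `coheight_graphClosure_le_of_isClosed`.
[cite: DeJong1996, 4.19, p. 73] -/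
theorem coheight_graphClosure_le [IsNoetherian S] (h : ThreePointSituation f σ p τ U β)
    (hX : Flat f) (t : ↥(graphClosure f p U β h.comm)) :
    coheight t ≤ coheight (graphClosureMap f p U β h.comm t) + 1 := by
  haveI := h.isProper
  haveI := h.isProper_model
  set π := graphClosureMap f p U β h.comm with hπ
  -- a closed point `z` of the fibre in the closure of `t`
  obtain ⟨z, hz, hzcl⟩ := (isClosed_closure (s := ({π.asFiber t} : Set ↥(π.fiber (π t))))).exists_closed_singleton
    ⟨π.asFiber t, subset_closure rfl⟩
  set t₀ := π.fiberι (π t) z with ht₀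
  have htt₀ : t ⤳ t₀ := by
    have := (specializes_iff_mem_closure.mpr hz).map (π.fiberι (π t)).continuous
    rwa [Scheme.Hom.fiberι_asFiber] at this
  have hπt₀ : π t₀ = π t := Literature.AlgebraicGeometry.Motives.apply_fiberι π _ z
  -- `t₀` is closed in its fibre
  have ht₀cl : ∀ e, π e = π t₀ → t₀ ⤳ e → e = t₀ := by
    intro e he hte
    have he' : π e = π t := he.trans hπt₀
    let eb : ↥(π.fiber (π t)) := (π.fiberHomeo (π t)).symm ⟨e, he'⟩
    have hzeb : z ⤳ eb := by
      rw [← (π.fiberι (π t)).isEmbedding.specializes_iff]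
      simpa [eb] using hte
    have : eb ∈ closure ({z} : Set ↥(π.fiber (π t))) := specializes_iff_mem_closure.mp hzeb
    rw [hzcl.closure_eq, Set.mem_singleton_iff] at this
    have := congrArg (fun w => (π.fiberι (π t) w : ↥(graphClosure f p U β h.comm))) this
    simpa [eb] using this
  -- hence `pr₂ t₀` is closed in its fibre
  have hx : IsClosed ({f.asFiber (graphClosureSnd f p U β h.comm t₀)} :
      Set ↥(f.fiber (f (graphClosureSnd f p U β h.comm t₀)))) := by
    refine isClosed_singleton_asFiber f (fun x' hx' hsx' => ?_)
    have hmem : x' ∈ graphClosureSnd f p U β h.comm '' closure {t₀} := by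
      rw [image_closure_singleton_of_isClosedMap (graphClosureSnd f p U β h.comm).continuous
        (graphClosureSnd f p U β h.comm).isClosedMap]
      exact specializes_iff_mem_closure.mp hsx'
    obtain ⟨e, he, rfl⟩ := hmem
    have hte : t₀ ⤳ e := specializes_iff_mem_closure.mpr he
    have hπe : π e = π t₀ := by
      show graphClosureMap f p U β h.comm e = graphClosureMap f p U β h.comm t₀
      rw [graphClosureMap_eq]
      exact hx'
    rw [ht₀cl e hπe hte]
  calc coheight t ≤ coheight t₀ := Order.coheight_anti (Scheme.le_iff_specializes.mpr htt₀)
    _ ≤ coheight (π t₀) + 1 := h.coheight_graphClosure_le_of_isClosed hX t₀ hx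
    _ = coheight (π t) + 1 := by rw [hπt₀]

omit [IsIntegral S] [LocallyOfFinitePresentation f] in
/-- The local rings of the base `S` (Noetherian) have finite dimension: `coheight s < ⊤`.
[folklore] -/
theorem coheight_base_ne_top [IsNoetherian S] (s : S) : coheight s ≠ ⊤ := by
  have h1 := ringKrullDim_lt_top (R := S.presheaf.stalk s)
  rw [ringKrullDim_stalk_eq_coheight] at h1
  intro htop
  rw [htop] at h1
  exact lt_irrefl _ (lt_of_lt_of_le h1 le_top)

/-- **No chain of three points in a fibre of `T → S`** (the fibres have dimension `≤ 1`): if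
`t₁ ⤳ t₂ ⤳ t₃` are points of `T` in one fibre with `t₁ ≠ t₂` and `t₂ ≠ t₃` then we reach
`dim 𝒪_{S,s} + 2 ≤ dim 𝒪_{T,t₃} ≤ dim 𝒪_{S,s} + 1`. [cite: DeJong1996, 4.19, p. 73] -/
theorem not_three_specializes_fiber_graphClosure [IsNoetherian S]
    (h : ThreePointSituation f σ p τ U β) (hX : Flat f) (hT : Flat (graphClosureMap f p U β h.comm))
    {t₁ t₂ t₃ : ↥(graphClosure f p U β h.comm)} (h₁₂ : t₁ ⤳ t₂) (h₂₃ : t₂ ⤳ t₃) (hne₁₂ : t₁ ≠ t₂)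
    (hne₂₃ : t₂ ≠ t₃) (hπ₁ : graphClosureMap f p U β h.comm t₁ = graphClosureMap f p U β h.comm t₃) :
    False := by
  have hlt₁₂ : t₂ < t₁ := by
    rw [lt_iff_le_not_ge, Scheme.le_iff_specializes, Scheme.le_iff_specializes]
    exact ⟨h₁₂, fun h' => hne₁₂ (h₁₂.antisymm h').eq⟩
  have hlt₂₃ : t₃ < t₂ := by
    rw [lt_iff_le_not_ge, Scheme.le_iff_specializes, Scheme.le_iff_specializes]
    exact ⟨h₂₃, fun h' => hne₂₃ (h₂₃.antisymm h').eq⟩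
  have c1 : coheight t₁ + 1 ≤ coheight t₂ := Order.coheight_add_one_le hlt₁₂
  have c2 : coheight t₂ + 1 ≤ coheight t₃ := Order.coheight_add_one_le hlt₂₃
  have lo := h.coheight_le_coheight_graphClosure hT t₁
  have up := h.coheight_graphClosure_le hX t₃
  rw [hπ₁] at lo
  have hfin := coheight_base_ne_top (graphClosureMap f p U β h.comm t₃)
  -- `coheight s + 2 ≤ coheight s + 1`
  have key : coheight (graphClosureMap f p U β h.comm t₃) + 1 + 1 ≤
      coheight (graphClosureMap f p U β h.comm t₃) + 1 :=
    calc coheight (graphClosureMap f p U β h.comm t₃) + 1 + 1 ≤ coheight t₁ + 1 + 1 :=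
          add_le_add (add_le_add lo le_rfl) le_rfl
      _ ≤ coheight t₂ + 1 := add_le_add c1 le_rfl
      _ ≤ coheight t₃ := c2
      _ ≤ coheight (graphClosureMap f p U β h.comm t₃) + 1 := up
  have hfin1 : coheight (graphClosureMap f p U β h.comm t₃) + 1 ≠ ⊤ := by
    simpa using hfin
  have h10 : (1 : ℕ∞) ≤ 0 := (ENat.add_le_add_iff_right hfin1).mp (by
    rw [zero_add, add_comm]; exact key)
  exact absurd h10 (by decide)

end DeJong1996.ThreePointSituation

end Literature.AlgebraicGeometry.Resolution

end
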